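import Mathlib
import Literature.MathematicalPhysics.QuantumFieldTheory.Balaban1983to89.LatticeFieldCalculus
import Literature.MathematicalPhysics.QuantumFieldTheory.Balaban1983to89.B6Eq250

/-!
# `Balaban1983to89.B6Eq239Commutator` — T. Bałaban, *Propagators and renormalization transformations for lattice
gauge theories. II*, Commun. Math. Phys. **96** (1984) 223–250 [Balaban1984PropagatorsII]: the explicit lattice formula
(2.39) of the commutator `K(h) = hΔ′_a − Δ′_ah` behind the random-walk expansion (2.38), PROVED on the torus calculus
of `…LatticeFieldCalculus`

statement-level skeleton of published theorems with citation tags; proofs where landed; nothing here is a claim about the Yang–Mills mass gap.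
PDF held: `paper:balaban1984-cmp96-propagators-rt-ii` (journal page = PDF page + 222); p. 229 [PDF 7] read from the ×2
render `run/shared/lean/pub/pub-balaban/b2b-balaban-ref1/pages/1984-cmp96-propagators-rt-II/1984-cmp96-propagators-rt-II-p007-x2.png`.

CITATION HEADER (cell `lit-balaban`, unit `lit-balaban-r03` gen 2 — B6 reader; SKELETON row `B6.Eq2.39` of
`HOME/lit-balaban-r03/ROWS-B6.md`, a G.2(b) knitting identity announced `TAKING B6.Eq2.39` in HOME/STATUS.md
2026-08-21T00:37Z).  IMPORTED, not modified: `…LatticeFieldCalculus` (the forward/backward differences `pdiff`/`pdiffAdj`,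
the gradient `grad`, the positive Laplacian `laplace c = Σ_μ ∂*_μ∂_μ` on the tori `Site P j`, [4] (1.21)) and `…B6Eq250`
(`kOp D h = hD − Dh`, the commutator of (2.38), p241200).
WHAT THE PAPER PRINTS (p. 229, verbatim): *"Repeating the calculations in the paper we get Δ′_aG′₀ = I − Σ_□ K(h_□)G′(□)h_□
= I − R, (2.38) where (K(h)λ)(x) = Σ_{b∈st(x)} (∂h)(b)(∂λ)(b) − (Δh)(x)λ(x) − a_j(L^jη)^{−2} Σ_{x′∈B^j(y^j(x))}
L^{−jd}(∂h)(Γ^{(j)}_{x,y^j(x),x′})λ(x′) if x ∈ B^j(Λ_j). (2.39) The derivatives above are on η-scale."*  Here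
`Δ′_a = Δ + Q′*aQ′` ((2.13)), `⟨λ, Q′*aQ′λ⟩ = Σ_j Σ_{y∈Λ_j} a_j(L^jη)^{d−2}|(Q′_jλ)(y)|²` ((2.14)), `(Q′_jλ)(y) =
Σ_{x∈B^j(y)} L^{−jd}λ(x)` ([3] (1.1)), `st(x)` = the 2d bonds at `x`, and `(∂h)(Γ)` = the sum of `η(∂h)(b)` along the
contour `Γ` ([4] (1.7)–(1.9)).
WHAT IS PROVED HERE (0 sorry, 0 named facts): with `K(h) := hΔ′_a − Δ′_ah` (the form in which (2.38) holds in any ring,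
`B6SectA.generator238` / `B6Eq250.eq238`):
(i) `laplace_part` — the Δ-part of (2.39) on every torus `Site P j` of the series' vocabulary, for real site functions:
`h(x)(Δλ)(x) − (Δ(hλ))(x) = Σ_μ [(∂h)(⟨x,x+e_μ⟩)(∂λ)(⟨x,x+e_μ⟩) + (∂h)(⟨x−e_μ,x⟩)(∂λ)(⟨x−e_μ,x⟩)] − (Δh)(x)λ(x)` — the sum
over `st(x)` written as forward + backward bond per direction (`laplace_part_pdiff` in `∂_μ`/`∂*_μ` form);
(ii) `average_part` — the Q′*aQ′-part, over ANY block structure (sites `X`, block label `blk : X → Y`, weight `w = L^{−jd}`,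
coupling `a = a_j(L^jη)^{−2}`): `h(x)(Aλ)(x) − (A(hλ))(x) = −a Σ_{x′ : blk x′ = blk x} w (h(x′) − h(x)) λ(x′)` for
`(Aλ)(x) := a Σ_{x′ ∈ block of x} w λ(x′)`;
(iii) `contour_telescope` — `(∂h)(Γ_{x,y,x′}) = h(x′) − h(x)` for every lattice contour from `x` to `x′` (telescoping; the
straight-segment case is `LatticeFieldCalculus.segSum_grad`);
(iv) `eq239` — the two parts assembled: for `Δ′ := Δ + A`, `(K(h)λ)(x) = (hΔ′λ − Δ′(hλ))(x)` equals the printed three-term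
expression, and `eq239_kOp` identifies `K(h)` with `B6Eq250.kOp` in the operator ring `Module.End ℝ (Site P j → ℝ)`.
NOT modelled: the multilevel bookkeeping `x ∈ B^j(Λ_j)` (which level's `a_j`, `B^j` apply at `x`) — (ii) is stated for
one block structure at a time, which is what (2.39) uses pointwise.
v1.1 (append-only, same seat): §4 `form214`/`form214_printed` — the quadratic form (2.14) `⟨λ,Q′*aQ′λ⟩ = Σ_y a_j(L^jη)^{d−2}|(Q′_jλ)(y)|²`
of the averaging operator `blockAvgOp` (one block structure), by fibrewise regrouping; §5 `eq240_scale`/`eq240_product` —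
(2.40) as the `L^{−j}`-rescaling of (2.39): `K(h)` is linear in `Δ′_a`, so `K^η(h) = s^{−2}K^ξ(h)` and `K^η(h)G′^η = K^ξ(h)G′^ξ`
when `G′^η = s²G′^ξ` (`…B6Eq294Scaling`).
-/

namespace Literature.MathematicalPhysics.QuantumFieldTheory.Balaban1983to89.B6Eq239Commutator

open Finset
open LatticeFieldCalculus (pdiff pdiffAdj grad laplace)

/-! ## §1. The Laplacian part of (2.39) on the torus `Site P j` -/

section Laplace

variable {P : Params} {j : ℕ}

/-- `(x − e_μ) + e_μ = x` (re-proved: the `LatticeFieldCalculus` copy is private). [folklore] -/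
private theorem shift_unshift (x : Site P j) (μ : Fin P.d) : (x.unshift μ).shift μ = x := by
  funext ν
  by_cases h : ν = μ
  · subst h; simp [Site.shift, Site.unshift]
  · simp [Site.shift, Site.unshift, Function.update_of_ne h]

/-- the backward bond at `x`: `(∂f)(⟨x − e_μ, x⟩) = −(∂*_μ f)(x)`. [cite: Balaban1984PropagatorsI, (1.21) p.21] -/
theorem grad_unshift (c : ℝ) (f : SiteField P j ℝ) (x : Site P j) (μ : Fin P.d) :
    grad c f ⟨x.unshift μ, μ⟩ = -pdiffAdj c μ f x := by
  simp only [grad, PBond.tgt, shift_unshift, pdiffAdj, smul_eq_mul]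
  ring

/-- **(2.39), Laplacian part, in `∂_μ`/`∂*_μ` form**: `h(x)(Δλ)(x) − (Δ(hλ))(x) =
Σ_μ [(∂_μh)(x)(∂_μλ)(x) + (∂*_μh)(x)(∂*_μλ)(x)] − (Δh)(x)λ(x)` (Δ = Σ_μ ∂*_μ∂_μ the positive η-lattice Laplacian).
[cite: Balaban1984PropagatorsII, (2.39) p.229] -/
theorem laplace_part_pdiff (c : ℝ) (h lam : SiteField P j ℝ) (x : Site P j) :
    h x * laplace c lam x - laplace c (h * lam) x =
      ∑ μ : Fin P.d, (pdiff c μ h x * pdiff c μ lam x + pdiffAdj c μ h x * pdiffAdj c μ lam x) -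
        laplace c h x * lam x := by
  simp only [laplace, pdiff, pdiffAdj, Pi.mul_apply, smul_eq_mul]
  rw [Finset.mul_sum, Finset.sum_mul, ← Finset.sum_sub_distrib, ← Finset.sum_sub_distrib]
  refine Finset.sum_congr rfl fun μ _ => ?_
  ring

/-- **(2.39), Laplacian part, as printed**: `h(x)(Δλ)(x) − (Δ(hλ))(x) = Σ_{b∈st(x)}(∂h)(b)(∂λ)(b) − (Δh)(x)λ(x)`, the
sum over the `2d` bonds at `x` written as the forward bond `⟨x, x+e_μ⟩` plus the backward bond `⟨x−e_μ, x⟩` in each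
direction (the product `(∂h)(b)(∂λ)(b)` does not depend on the orientation of `b`).
[cite: Balaban1984PropagatorsII, (2.39) p.229] -/
theorem laplace_part (c : ℝ) (h lam : SiteField P j ℝ) (x : Site P j) :
    h x * laplace c lam x - laplace c (h * lam) x =
      ∑ μ : Fin P.d, (grad c h ⟨x, μ⟩ * grad c lam ⟨x, μ⟩ +
          grad c h ⟨x.unshift μ, μ⟩ * grad c lam ⟨x.unshift μ, μ⟩) - laplace c h x * lam x := by
  rw [laplace_part_pdiff]
  congr 1
  refine Finset.sum_congr rfl fun μ _ => ?_
  rw [LatticeFieldCalculus.grad_apply, LatticeFieldCalculus.grad_apply, grad_unshift, grad_unshift]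
  ring

end Laplace

/-! ## §2. The averaging part of (2.39) (any block structure) and the contour telescoping -/

section Average

variable {X Y : Type*} [Fintype X] [DecidableEq Y]

/-- the block-averaging operator `(Aλ)(x) = a·Σ_{x′ ∈ block(x)} w·λ(x′)` — `Q′_j*a_jQ′_j` at a site `x ∈ B^j(y)`,
`y = blk x`, with `w = L^{−jd}` and `a = a_j(L^jη)^{−2}` ((2.13)–(2.14), [3] (1.1)). [cite: Balaban1984PropagatorsII, (2.13)–(2.14) p.225] -/
def blockAvgOp (blk : X → Y) (a w : ℝ) (lam : X → ℝ) (x : X) : ℝ :=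
  a * ∑ x' ∈ univ.filter (fun x' => blk x' = blk x), w * lam x'

/-- **(2.39), averaging part**: `h(x)(Aλ)(x) − (A(hλ))(x) = −a Σ_{x′∈B^j(y^j(x))} w (h(x′) − h(x)) λ(x′)` — the printed
third term, with `(∂h)(Γ^{(j)}_{x,y^j(x),x′}) = h(x′) − h(x)` (`contour_telescope`).
[cite: Balaban1984PropagatorsII, (2.39) p.229] -/
theorem average_part (blk : X → Y) (a w : ℝ) (h lam : X → ℝ) (x : X) :
    h x * blockAvgOp blk a w lam x - blockAvgOp blk a w (h * lam) x =
      -(a * ∑ x' ∈ univ.filter (fun x' => blk x' = blk x), w * (h x' - h x) * lam x') := by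
  simp only [blockAvgOp, Pi.mul_apply]
  rw [← mul_assoc, mul_comm (h x) a, mul_assoc, Finset.mul_sum, ← mul_sub, ← mul_neg,
    ← Finset.sum_sub_distrib, ← Finset.sum_neg_distrib]
  congr 1
  refine Finset.sum_congr rfl fun x' _ => ?_
  ring

omit [Fintype X] [DecidableEq Y] in
/-- **`(∂h)(Γ) = h(end) − h(start)`** for every lattice contour `Γ = (z₀, z₁, …, z_n)`: the sum of the increments
`h(z_{i+1}) − h(z_i)` (= `η·(∂h)(b_i)` for the bond `b_i = ⟨z_i, z_{i+1}⟩` on the η-lattice) telescopes; the straight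
segments of the staircase `Γ_{x,y,x′}` are `LatticeFieldCalculus.segSum_grad`. [cite: Balaban1984PropagatorsI, (1.7)–(1.9) p.19] -/
theorem contour_telescope (h : X → ℝ) (n : ℕ) (z : ℕ → X) :
    ∑ i ∈ range n, (h (z (i + 1)) - h (z i)) = h (z n) - h (z 0) :=
  Finset.sum_range_sub (fun i => h (z i)) n

end Average

/-! ## §3. (2.39) assembled for `Δ′_a = Δ + Q′*aQ′`, and `K(h)` as the commutator of (2.38) -/

section Assembled

variable {P : Params} {j : ℕ} {Y : Type*} [DecidableEq Y]

/-- `Δ′_a = Δ + Q′*aQ′` acting on real site functions of one torus with one block structure (the level-`j` piece of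
(2.13)). [cite: Balaban1984PropagatorsII, (2.13) p.225] -/
def deltaPrimeA (c : ℝ) (blk : Site P j → Y) (a w : ℝ) (lam : SiteField P j ℝ) : SiteField P j ℝ :=
  fun x => laplace c lam x + blockAvgOp blk a w lam x

/-- **(2.39) PROVED**: for `K(h)λ := hΔ′_aλ − Δ′_a(hλ)`,
`(K(h)λ)(x) = Σ_{b∈st(x)}(∂h)(b)(∂λ)(b) − (Δh)(x)λ(x) − a Σ_{x′∈B(y(x))} w (h(x′) − h(x)) λ(x′)`.
[cite: Balaban1984PropagatorsII, (2.39) p.229] -/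
theorem eq239 (c : ℝ) (blk : Site P j → Y) (a w : ℝ) (h lam : SiteField P j ℝ) (x : Site P j) :
    h x * deltaPrimeA c blk a w lam x - deltaPrimeA c blk a w (h * lam) x =
      (∑ μ : Fin P.d, (grad c h ⟨x, μ⟩ * grad c lam ⟨x, μ⟩ +
          grad c h ⟨x.unshift μ, μ⟩ * grad c lam ⟨x.unshift μ, μ⟩) - laplace c h x * lam x) -
        a * ∑ x' ∈ univ.filter (fun x' => blk x' = blk x), w * (h x' - h x) * lam x' := by
  have h1 := laplace_part c h lam x
  have h2 := average_part blk a w h lam x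
  simp only [deltaPrimeA]
  linear_combination h1 + h2

/-- `K(h)` IS the commutator `kOp` of `B6Eq250` (2.38) in the operator ring `Module.End ℝ (SiteField P j ℝ)`: with `D` =
`Δ′_a` and `M_h` = multiplication by `h` as linear maps, `(kOp D M_h)λ = hΔ′_aλ − Δ′_a(hλ)` pointwise — so (2.39) is the
kernel of the operator whose Neumann series is (2.50). [cite: Balaban1984PropagatorsII, (2.38)–(2.39) p.229] -/
theorem eq239_kOp (D Mh : Module.End ℝ (SiteField P j ℝ)) (h : SiteField P j ℝ) (hM : ∀ f, Mh f = h * f)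
    (lam : SiteField P j ℝ) (x : Site P j) :
    (B6Eq250.kOp D Mh) lam x = h x * D lam x - D (h * lam) x := by
  rw [B6Eq250.kOp_def, LinearMap.sub_apply, Module.End.mul_apply, Module.End.mul_apply, hM, hM]
  rfl

end Assembled

/-! ## §4. (2.14): the quadratic form `⟨λ, Q′*aQ′λ⟩` of the averaging part (v1.1) -/

section Form214

variable {X Y : Type*} [Fintype X] [Fintype Y] [DecidableEq Y]

/-- **(2.14), one block structure**: `⟨λ, Q′*aQ′λ⟩ = Σ_y a_j(L^jη)^{d−2}|(Q′_jλ)(y)|²` in the form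
`Σ_x c·λ(x)·(Aλ)(x) = (c·a/w)·Σ_y (Σ_{x∈B(y)} w·λ(x))²` for the pointwise averaging operator `A = blockAvgOp blk a w`
(pairing weight `c = η^d`, block weight `w = L^{−jd} ≠ 0`, coupling `a = a_j(L^jη)^{−2}`; `(Q′_jλ)(y) = Σ_{x∈B^j(y)} wλ(x)`):
group the `x`-sum by blocks and factor each block's sum. [cite: Balaban1984PropagatorsII, (2.13)–(2.14) p.225] -/
theorem form214 (blk : X → Y) (a w c : ℝ) (hw : w ≠ 0) (lam : X → ℝ) :
    ∑ x, c * (lam x * blockAvgOp blk a w lam x) =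
      c * a / w * ∑ y, (∑ x ∈ univ.filter (fun x => blk x = y), w * lam x) ^ 2 := by
  have fib : ∀ f : X → ℝ, ∑ x, f x = ∑ y, ∑ x ∈ univ.filter (fun x => blk x = y), f x := fun f =>
    (Finset.sum_fiberwise_of_maps_to (s := univ) (t := univ) (g := blk) (fun _ _ => mem_univ _) f).symm
  rw [fib, Finset.mul_sum]
  refine Finset.sum_congr rfl fun y _ => ?_
  have inner : ∀ x ∈ univ.filter (fun x => blk x = y),
      c * (lam x * blockAvgOp blk a w lam x) =
        c * a / w * ((w * lam x) * ∑ x' ∈ univ.filter (fun x' => blk x' = y), w * lam x') := by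
    intro x hx
    have hx' : blk x = y := (Finset.mem_filter.mp hx).2
    simp only [blockAvgOp, hx']
    field_simp
  rw [Finset.sum_congr rfl inner, ← Finset.mul_sum, ← Finset.sum_mul, sq]

/-- **(2.14) with the printed weights**: `c = η^d`, `w = L^{−jd}` (written `1/L_j^d`, `L_j = L^j`), `a = a_j(L^jη)^{−2}`
give the printed coefficient `a_j(L^jη)^{d−2}` (written `a_j(L_jη)^d/(L_jη)^2`).
[cite: Balaban1984PropagatorsII, (2.14) p.225] -/
theorem form214_printed (blk : X → Y) {Lj η : ℝ} (hL : 0 < Lj) (hη : 0 < η) (aj : ℝ) (d : ℕ) (lam : X → ℝ) :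
    ∑ x, η ^ d * (lam x * blockAvgOp blk (aj / (Lj * η) ^ 2) (1 / Lj ^ d) lam x) =
      aj * (Lj * η) ^ d / (Lj * η) ^ 2 *
        ∑ y, (∑ x ∈ univ.filter (fun x => blk x = y), 1 / Lj ^ d * lam x) ^ 2 := by
  rw [form214 blk _ _ _ (by positivity) lam]
  congr 1
  rw [mul_pow]
  field_simp
  ring

end Form214

/-! ## §5. (2.40): `K(h)` rescaled to the `L^{−j}`-lattice (v1.1) -/

section Eq240

variable {𝔄 : Type*} [Ring 𝔄] [Algebra ℝ 𝔄]

/-- **(2.40) is (2.39) on the `L^{−j}`-scale**: the commutator `K(h) = hD − Dh` (`B6Eq250.kOp`) is linear in the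
operator `D`, so rescaling `Δ′_a` from the `η`-lattice to the `L^{−j}`-lattice, `D^η = s^{−2}·D^ξ` (`s = L^jη`; the
derivatives and the coupling `a_j(L^jη)^{−2} ↦ a_j` rescale by the same factor, `B6Eq294Scaling.laplace_scale`), rescales
`K(h)` by the same factor: `K^η(h) = s^{−2}·K^ξ(h)` — the content of *"Rescaling all the expressions in K(h_□)G′(□)h_□λ to
L^{−j}-scale, we get (2.40)"* (p. 230), where the factor is absorbed into `G′(□)` *"defined on L^{−j}-scale"*.
[cite: Balaban1984PropagatorsII, (2.40) p.230] -/
theorem eq240_scale (t : ℝ) (D Mh : 𝔄) : B6Eq250.kOp (t • D) Mh = t • B6Eq250.kOp D Mh := by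
  rw [B6Eq250.kOp_def, B6Eq250.kOp_def, smul_sub, mul_smul_comm, smul_mul_assoc]

/-- … and the product `K(h)G′` is scale-free when `G′` absorbs the inverse factor (`G′^η = s²G′^ξ`,
`B6Eq294Scaling.inverse_scale`): `K^η(h)G′^η = K^ξ(h)G′^ξ` for `t·t′ = 1`. [cite: Balaban1984PropagatorsII, (2.40) p.230] -/
theorem eq240_product (t t' : ℝ) (ht : t * t' = 1) (D G Mh : 𝔄) :
    B6Eq250.kOp (t • D) Mh * (t' • G) = B6Eq250.kOp D Mh * G := by
  rw [eq240_scale, smul_mul_smul_comm, ht, one_smul]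

end Eq240

end Literature.MathematicalPhysics.QuantumFieldTheory.Balaban1983to89.B6Eq239Commutator
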